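import Mathlib

/-!
# The socle of `ad⁰` of a non-split upper-triangular representation, and stable adjoint
lines modulo `p²` (algebraic core of LEMMA D, solo-informed s46)

Two pieces of `2 × 2` linear algebra used throughout the cell programme (FINDING_L LEMMA L2,
FINDING_S PROPOSITION S (S1), FINDING_D LEMMA D0/D1).

**Socle.**  Let `G` be a set of upper-triangular matrices `g = (g₀₀, *; 0, g₁₁)` over a field `K`
of characteristic `≠ 2` containing a unipotent `u = (1, c; 0, 1)` with `c ≠ 0` (the image of a
*non-split* reducible representation `ρ̄ = (χ₁, *; 0, χ₂)` in an adapted basis).  If a non-zero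
trace-zero matrix `X` spans a `G`-stable line of `ad⁰ ρ̄ ⊗ ψ`, i.e. `ψ(g) • (g X) = X g` for all
`g ∈ G`, then `X` is a multiple of `E₁₂ = (0, 1; 0, 0)` and `ψ(g) g₀₀ = g₁₁` on `G`:
the socle of `ad⁰ ρ̄` is the line `K E₁₂` with character `χ₁ χ₂⁻¹`, and
`H⁰(G, ad⁰ ρ̄ ⊗ ψ) ≠ 0 ⟹ ψ = χ₂ χ₁⁻¹`.
* `unipotent_mul_eq_smul_mul` : an `Ad(u)`-eigenvector has eigenvalue `1`;
* `eq_E12_of_commute_unipotent` : a trace-zero matrix commuting with `u` is a multiple of `E₁₂`;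
* `upperTriangular_mul_E12`, `E12_mul_upperTriangular`, `character_of_E12_line` : the character;
* `adjoint_invariants_eq_E12_line` : the packaged statement.

**Stable lines modulo `p²`.**  Over a commutative ring with `p · p = 0` (e.g. `ℤ/p²`), let
`v = E₁₂ + p W` with `tr W = 0` span an `Ad`-stable line.  Then `v² = (p W₁₀) · 1` is central
(`sq_E12_add_smul`), so `Ad(g) v = t v` with `1 − t²` a unit forces `p W₁₀ = 0`
(`p_mul_lowerLeft_eq_zero`); and then the column space of `v` is the free line spanned by the
unimodular vector `u = (1 + p W₀₁, p W₁₁) ≡ e₁`, which every such `g` preserves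
(`isUnit_one_add_p_mul`, `mulVec_E12_add_smul`, `mulVec_mem_line`).  Reading (LEMMA D0): if
`ad⁰(ρ mod p²)` contains a `G`-stable free line with character `λ`, `λ² ≢ 1 (mod p)`, then
`ρ mod p²` stabilises a free line lifting the residual sub-line — for the base-changed Ribet
lattice this is excluded by PROPOSITION S (`κ₀ ≠ 0`), whence `H⁰(G_F, ad⁰(Λ/7^k)(1)) = ℤ/7`
for every `k` (LEMMA D1).

No number theory is formalised here.
-/

namespace Summit.Langlands.Langlands.Theorems

section Socle

variable {K : Type*} [Field K]

/-- An `Ad(u)`-eigenvector for the unipotent `u = (1, c; 0, 1)` has eigenvalue `1`: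
if `u X = t • (X u)` with `X ≠ 0` then `t = 1`. -/
theorem unipotent_mul_eq_smul_mul {c t : K} {X : Matrix (Fin 2) (Fin 2) K} (hX : X ≠ 0)
    (h : !![1, c; 0, 1] * X = t • (X * !![1, c; 0, 1])) : t = 1 := by
  by_contra ht
  have h10 := congrFun (congrFun h 1) 0
  have h11 := congrFun (congrFun h 1) 1
  have h00 := congrFun (congrFun h 0) 0
  have h01 := congrFun (congrFun h 0) 1
  simp [Matrix.mul_apply, Fin.sum_univ_two] at h10 h11 h00 h01
  have ht' : (1 - t) ≠ 0 := sub_ne_zero.mpr (Ne.symm ht)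
  have e10 : X 1 0 = 0 := by
    have : (1 - t) * X 1 0 = 0 := by linear_combination h10
    exact (mul_eq_zero.mp this).resolve_left ht'
  have e11 : X 1 1 = 0 := by
    have : (1 - t) * X 1 1 = 0 := by rw [e10] at h11; linear_combination h11
    exact (mul_eq_zero.mp this).resolve_left ht'
  have e00 : X 0 0 = 0 := by
    have : (1 - t) * X 0 0 = 0 := by rw [e10] at h00; linear_combination h00
    exact (mul_eq_zero.mp this).resolve_left ht'
  have e01 : X 0 1 = 0 := by
    have : (1 - t) * X 0 1 = 0 := by rw [e11, e00] at h01; linear_combination h01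
    exact (mul_eq_zero.mp this).resolve_left ht'
  apply hX
  ext i j
  fin_cases i <;> fin_cases j <;> simp [e00, e01, e10, e11]

/-- A trace-zero matrix commuting with the unipotent `u = (1, c; 0, 1)`, `c ≠ 0`, over a field of
characteristic `≠ 2` is a multiple of `E₁₂`: the centraliser of a non-split extension class in
`ad⁰` is the line `K E₁₂`. -/
theorem eq_E12_of_commute_unipotent {c : K} (hc : c ≠ 0) (h2 : (2 : K) ≠ 0)
    {X : Matrix (Fin 2) (Fin 2) K} (htr : X.trace = 0)
    (h : !![1, c; 0, 1] * X = X * !![1, c; 0, 1]) : X = !![0, X 0 1; 0, 0] := by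
  have h00 := congrFun (congrFun h 0) 0
  have h01 := congrFun (congrFun h 0) 1
  simp [Matrix.mul_apply, Fin.sum_univ_two, -mul_eq_zero, -mul_eq_mul_left_iff,
    -mul_eq_mul_right_iff] at h00 h01
  rw [Matrix.trace_fin_two] at htr
  have e10 : X 1 0 = 0 := by
    have : c * X 1 0 = 0 := by linear_combination h00
    exact (mul_eq_zero.mp this).resolve_left hc
  have e0011 : X 0 0 = X 1 1 := by
    have : c * (X 1 1 - X 0 0) = 0 := by linear_combination h01
    have := (mul_eq_zero.mp this).resolve_left hc
    linear_combination -this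
  have e00 : X 0 0 = 0 := by
    have : (2 : K) * X 0 0 = 0 := by linear_combination htr + e0011
    exact (mul_eq_zero.mp this).resolve_left h2
  have e11 : X 1 1 = 0 := by rw [← e0011, e00]
  ext i j
  fin_cases i <;> fin_cases j <;> simp [e00, e10, e11]

/-- Left multiplication of `E₁₂`-multiples by an upper-triangular matrix. -/
theorem upperTriangular_mul_E12 (s m r b : K) :
    !![s, m; 0, r] * !![0, b; 0, 0] = !![0, s * b; 0, 0] := by
  ext i j
  fin_cases i <;> fin_cases j <;> simp [Matrix.mul_apply, Fin.sum_univ_two]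

/-- Right multiplication of `E₁₂`-multiples by an upper-triangular matrix. -/
theorem E12_mul_upperTriangular (s m r b : K) :
    !![0, b; 0, 0] * !![s, m; 0, r] = !![0, b * r; 0, 0] := by
  ext i j
  fin_cases i <;> fin_cases j <;> simp [Matrix.mul_apply, Fin.sum_univ_two]

/-- The character of the line `K E₁₂` under an upper-triangular `g = (s, m; 0, r)`:
if `ψ • (g X) = X g` for `X = b E₁₂`, `b ≠ 0`, then `ψ s = r`, i.e. `ψ = χ₂ χ₁⁻¹ (g)`. -/
theorem character_of_E12_line {s m r b ψ : K} (hb : b ≠ 0)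
    (h : ψ • (!![s, m; 0, r] * !![0, b; 0, 0]) = !![0, b; 0, 0] * !![s, m; 0, r]) :
    ψ * s = r := by
  rw [upperTriangular_mul_E12, E12_mul_upperTriangular] at h
  have h01 := congrFun (congrFun h 0) 1
  simp at h01
  have : (ψ * s - r) * b = 0 := by linear_combination h01
  have := (mul_eq_zero.mp this).resolve_right hb
  linear_combination this

/-- THE SOCLE OF `ad⁰` (packaged).  Let `G` be a set of upper-triangular `2 × 2` matrices over a
field with `2 ≠ 0`, containing a unipotent `(1, c; 0, 1)` with `c ≠ 0` (non-split residual
representation `ρ̄ = (χ₁, *; 0, χ₂)` in an adapted basis), and let `ψ : G → K`.  If a non-zero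
trace-zero `X` satisfies `ψ(g) • (g X) = X g` for all `g ∈ G` — i.e. `X ∈ H⁰(G, ad⁰ρ̄ ⊗ ψ)` — then
`X` is a multiple of `E₁₂` and `ψ(g) · g₀₀ = g₁₁` for every `g ∈ G`:
`soc(ad⁰ρ̄) = K E₁₂` with character `χ₁χ₂⁻¹`, and `H⁰(G, ad⁰ρ̄ ⊗ ψ) ≠ 0 ⟹ ψ = χ₂χ₁⁻¹` on `G`. -/
theorem adjoint_invariants_eq_E12_line (h2 : (2 : K) ≠ 0)
    (G : Set (Matrix (Fin 2) (Fin 2) K)) (hG : ∀ g ∈ G, g 1 0 = 0)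
    {c : K} (hc : c ≠ 0) (hu : !![1, c; 0, 1] ∈ G)
    (ψ : Matrix (Fin 2) (Fin 2) K → K)
    {X : Matrix (Fin 2) (Fin 2) K} (hX : X ≠ 0) (htr : X.trace = 0)
    (hinv : ∀ g ∈ G, ψ g • (g * X) = X * g) :
    X = !![0, X 0 1; 0, 0] ∧ X 0 1 ≠ 0 ∧ ∀ g ∈ G, ψ g * g 0 0 = g 1 1 := by
  -- Step 1: `ψ(u) ≠ 0` and `u X = ψ(u)⁻¹ • X u`, so `ψ(u)⁻¹ = 1` and `X` commutes with `u`.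
  have hu' := hinv _ hu
  have hψu : ψ !![1, c; 0, 1] ≠ 0 := by
    intro h0
    rw [h0, zero_smul] at hu'
    -- then `X u = 0`, and `u` is invertible, so `X = 0`
    have hdet : (!![1, c; 0, 1] : Matrix (Fin 2) (Fin 2) K).det = 1 := by
      simp [Matrix.det_fin_two]
    have : X = 0 := by
      have hXu : X * !![1, c; 0, 1] = 0 := hu'.symm
      have := congrArg (· * (!![1, c; 0, 1] : Matrix (Fin 2) (Fin 2) K)⁻¹) hXu
      simp only [zero_mul] at this
      rwa [Matrix.mul_nonsing_inv_cancel_right] at this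
      rw [hdet]; exact isUnit_one
    exact hX this
  have hcomm' : !![1, c; 0, 1] * X = (ψ !![1, c; 0, 1])⁻¹ • (X * !![1, c; 0, 1]) := by
    rw [← hu', smul_smul, inv_mul_cancel₀ hψu, one_smul]
  have hone : (ψ !![1, c; 0, 1])⁻¹ = 1 := unipotent_mul_eq_smul_mul hX hcomm'
  rw [hone, one_smul] at hcomm'
  -- Step 2: `X` is a multiple of `E₁₂`.
  have hE : X = !![0, X 0 1; 0, 0] := eq_E12_of_commute_unipotent hc h2 htr hcomm'
  have hb : X 0 1 ≠ 0 := by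
    intro h0
    apply hX
    rw [hE, h0]
    ext i j
    fin_cases i <;> fin_cases j <;> simp
  refine ⟨hE, hb, fun g hg => ?_⟩
  -- Step 3: the character.
  have hg' : g = !![g 0 0, g 0 1; 0, g 1 1] := by
    rw [← hG g hg]
    exact Matrix.eta_fin_two g
  have hmul := hinv g hg
  rw [hE] at hmul
  rw [hg'] at hmul
  have key := character_of_E12_line hb hmul
  rw [← hg'] at key
  exact key

end Socle

section StableLine

variable {R : Type*} [CommRing R]

/-- `(E₁₂ + p W)² = (p W₁₀) · 1 + (p · tr W) E₁₂` when `p · p = 0`. -/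
theorem sq_E12_add_smul_aux {p : R} (hp : p * p = 0) (W : Matrix (Fin 2) (Fin 2) R) :
    (!![0, 1; 0, 0] + p • W) * (!![0, 1; 0, 0] + p • W)
      = (p * W 1 0) • (1 : Matrix (Fin 2) (Fin 2) R) + (p * W.trace) • !![0, 1; 0, 0] := by
  rw [Matrix.trace_fin_two]
  ext i j
  fin_cases i <;> fin_cases j
  · simp [Matrix.mul_apply, Fin.sum_univ_two]
    linear_combination (W 0 0 * W 0 0 + W 0 1 * W 1 0) * hp
  · simp [Matrix.mul_apply, Fin.sum_univ_two]
    linear_combination (W 0 0 * W 0 1 + W 0 1 * W 1 1) * hp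
  · simp [Matrix.mul_apply, Fin.sum_univ_two]
    linear_combination (W 1 0 * W 0 0 + W 1 1 * W 1 0) * hp
  · simp [Matrix.mul_apply, Fin.sum_univ_two]
    linear_combination (W 1 0 * W 0 1 + W 1 1 * W 1 1) * hp

/-- THE CENTRAL SQUARE.  If `p · p = 0` and `tr W = 0` then `v = E₁₂ + p W` satisfies
`v² = (p W₁₀) · 1`, a scalar matrix. -/
theorem sq_E12_add_smul {p : R} (hp : p * p = 0) (W : Matrix (Fin 2) (Fin 2) R)
    (htr : W.trace = 0) :
    (!![0, 1; 0, 0] + p • W) * (!![0, 1; 0, 0] + p • W)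
      = (p * W 1 0) • (1 : Matrix (Fin 2) (Fin 2) R) := by
  rw [sq_E12_add_smul_aux hp, htr, mul_zero, zero_smul, add_zero]

/-- `Ad`-eigenvectors square to `Ad`-eigenvectors with the squared eigenvalue:
`g v = t (v g) ⟹ g v² = t² (v² g)`. -/
theorem mul_sq_eq_smul_sq_mul {t : R} {g v : Matrix (Fin 2) (Fin 2) R}
    (h : g * v = t • (v * g)) : g * (v * v) = (t * t) • (v * v * g) := by
  calc g * (v * v) = (g * v) * v := (Matrix.mul_assoc _ _ _).symm
    _ = (t • (v * g)) * v := by rw [h]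
    _ = t • (v * (g * v)) := by rw [Matrix.smul_mul, Matrix.mul_assoc]
    _ = t • (v * (t • (v * g))) := by rw [h]
    _ = (t * t) • (v * v * g) := by
      rw [Matrix.mul_smul, smul_smul, ← Matrix.mul_assoc]

/-- LEMMA D0, step 1.  Let `p · p = 0`, `tr W = 0`, `v = E₁₂ + p W`, and suppose some invertible
`g` satisfies `g v = t • v g` with `1 − t²` a unit (the stable adjoint line has a character
`λ` with `λ² ≢ 1`).  Then `p W₁₀ = 0`, i.e. `v² = 0`. -/
theorem p_mul_lowerLeft_eq_zero {p t : R} (hp : p * p = 0) (W : Matrix (Fin 2) (Fin 2) R)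
    (htr : W.trace = 0) {g g' : Matrix (Fin 2) (Fin 2) R} (hgg' : g * g' = 1)
    (h : g * (!![0, 1; 0, 0] + p • W) = t • ((!![0, 1; 0, 0] + p • W) * g))
    (ht : IsUnit (1 - t * t)) : p * W 1 0 = 0 := by
  have hsq := sq_E12_add_smul hp W htr
  have h2 := mul_sq_eq_smul_sq_mul h
  rw [hsq, Matrix.mul_smul, Matrix.mul_one, Matrix.smul_mul, Matrix.one_mul, smul_smul] at h2
  -- `(p W₁₀) • g = (t² p W₁₀) • g`; cancel `g` on the right by `g'`.
  have h3 := congrArg (· * g') h2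
  simp only [Matrix.smul_mul, hgg'] at h3
  have h4 := congrFun (congrFun h3 0) 0
  simp at h4
  -- `p W₁₀ = t² p W₁₀`, so `(1 - t²) (p W₁₀) = 0`.
  have h5 : (1 - t * t) * (p * W 1 0) = 0 := by linear_combination h4
  obtain ⟨w, hw⟩ := ht
  rw [← hw] at h5
  have := congrArg (fun x => (↑w⁻¹ : R) * x) h5
  simpa [← mul_assoc, Units.inv_mul] using this

/-- The first coordinate of `u = v e₂ = (1 + p W₀₁, p W₁₁)` is a unit when `p · p = 0`:
`u` is unimodular and `≡ e₁ (mod p)`. -/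
theorem isUnit_one_add_p_mul {p : R} (hp : p * p = 0) (x : R) : IsUnit (1 + p * x) := by
  refine isUnit_iff_exists_inv.mpr ⟨1 - p * x, ?_⟩
  linear_combination (-(x * x)) * hp

/-- LEMMA D0, step 2 (the line).  With `p · p = 0` and `p W₁₀ = 0`, every vector `v w`,
`v = E₁₂ + p W`, is a multiple of `u = (1 + p W₀₁, p W₁₁)` (the second column of `v`):
explicitly `v w = (w₀ W₀₀ p + w₁) • u`.  Hence the column space of `v` is the free line `R u`. -/
theorem mulVec_E12_add_smul {p : R} (hp : p * p = 0) (W : Matrix (Fin 2) (Fin 2) R)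
    (h10 : p * W 1 0 = 0) (w : Fin 2 → R) :
    (!![0, 1; 0, 0] + p • W).mulVec w
      = (w 0 * W 0 0 * p + w 1) • ![1 + p * W 0 1, p * W 1 1] := by
  ext i
  fin_cases i
  · simp [Matrix.mulVec, dotProduct, Fin.sum_univ_two]
    linear_combination (-(w 0 * W 0 0 * W 0 1)) * hp
  · simp [Matrix.mulVec, dotProduct, Fin.sum_univ_two]
    linear_combination w 0 * h10 - (w 0 * W 0 0 * W 1 1) * hp

/-- `(t • A) v = t • (A v)` (scalar–matrix–vector associativity, spelled out). -/
theorem smul_mulVec_eq (t : R) (A : Matrix (Fin 2) (Fin 2) R) (w : Fin 2 → R) :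
    (t • A).mulVec w = t • A.mulVec w := by
  ext i
  simp only [Matrix.mulVec, dotProduct, Matrix.smul_apply, Pi.smul_apply, smul_eq_mul,
    Finset.mul_sum, mul_assoc]

/-- LEMMA D0, step 3 (stability).  If moreover `g v = t • v g`, then `g` maps the line `R u`
into itself: `g u = s • u` with `s = t ((g e₂)₀ W₀₀ p + (g e₂)₁)`. -/
theorem mulVec_mem_line {p t : R} (hp : p * p = 0) (W : Matrix (Fin 2) (Fin 2) R)
    (h10 : p * W 1 0 = 0) {g : Matrix (Fin 2) (Fin 2) R}
    (h : g * (!![0, 1; 0, 0] + p • W) = t • ((!![0, 1; 0, 0] + p • W) * g)) :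
    ∃ s : R, g.mulVec ![1 + p * W 0 1, p * W 1 1] = s • ![1 + p * W 0 1, p * W 1 1] := by
  -- `u = v e₂` with `e₂ = ![0, 1]`
  have hu : (!![0, 1; 0, 0] + p • W).mulVec ![0, 1] = ![1 + p * W 0 1, p * W 1 1] := by
    rw [mulVec_E12_add_smul hp W h10]
    simp
  refine ⟨t * ((g.mulVec ![0, 1]) 0 * W 0 0 * p + (g.mulVec ![0, 1]) 1), ?_⟩
  rw [← hu, Matrix.mulVec_mulVec, h, smul_mulVec_eq, ← Matrix.mulVec_mulVec,
    mulVec_E12_add_smul hp W h10 (g.mulVec ![0, 1]), smul_smul, hu]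

end StableLine

end Summit.Langlands.Langlands.Theorems
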